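import Summits.ResolutionOfSingularities.ResolutionOfSingularities.Theorems.FrobeniusClosingPatchingRelPerfectDepthMultiHostCyl
import Summits.ResolutionOfSingularities.ResolutionOfSingularities.Theorems.FrobeniusClosingPatchingRelPerfectDepthMultiHostCJSTransportStep
import Summits.ResolutionOfSingularities.ResolutionOfSingularities.Theorems.FrobeniusClosingPatchingRelPerfectDepthMultiHostFormatSnc
import Summits.ResolutionOfSingularities.ResolutionOfSingularities.Theorems.FrobeniusClosingPatchingRelPerfectDepthGradedTargets
import Literature.Topology.KrullDimensionDrop
import HarnessLib

/-!
# Crux `PatchingRelPerfect` (stmt-ResolutionOfSingularities-16161), chain W5.2 — TYPED TARGETS for F7(β) (β-AX) d = 2 (spec v4.3 §2/§7/§8):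
# `StepStable` · T2 `CJSTransport₂` · T2c `FormatEndOnCyl₂` · T0 `InitialMultiHost₂` · `AtlasInitial` · T3 `PhaseCTermination₂` ·
# `BetaTwoAtomConclusion₂` · T5 statement `BetaTwoComposition₂`

[OURS · L1 W5.2 · F7(β) (β-AX)] Statements (Props) only — the typed targets of the (β-AX) assembly; NOT statements of the manuscript under
review; candidates, not facts; AI-written, weaker than expert review.  AUTHOR of the statements: res-L1-w52-plan-1 g11, targets scratch v5
`L/res-L1-w52-plan-1/ChainW52TargetsF7Beta.scratch.lean` sha16 02199407863f25a1 (RULINGs G11-24/25/26/27/28/28′/29; farm rc 0 · 0 · 0), reviewed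
on the bus by res-D-pv-021 (E1/T4), res-D-pv-054 (T2, `StepStable` text = its `hP` binder), res-D-pv-055 (T0, Q-T0-1/3), res-L1-w52-idea-1
(T3/P3 shape, NOTE G11-28′).  FILED VERBATIM (statements untouched; this header replaces the scratch header) by res-D-repro-1 AS res-L1-repro-3
on res-L1-w52-plan-1 NAMING G11-29 (3)(a).  Versions folded: v4 — T0 gains `Scheme.IsExcellent X ∧ cyl.V = ⊤` (G11-27: `V := ⊤`, `q := R₀`),
`AtlasInitial`, T3 `PhaseCTermination₂ P` typed P-parametrically in the RESIDUAL CURRENCY of G11-25 A8/A9 (conclusion: the abstract factorisation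
`S.K.comap s.comp = M * Sf.K`, `M` effective Cartier, `Sf` format-snc on `U′ ⊇ cosupp Sf.K` — `MultiHostState.residual` of
`…DepthMultiHostResidual` p550707 is the canonical witness), `BetaTwoAtomConclusion₂`, `BetaTwoComposition₂`; v5 — `StepStable` RESTRICTED
(`ν := 0`, `m` maximal; G11-26 (2)), T0 binder `∀ j, P j ≠ 0` (Q-T0-3).  T2 `CJSTransport₂` = the ∃-conclusion of res-D-pv-054's
`MultiHostCJS.transport_of_cjsB (hlift) (hCJS)` universally closed; T2c `FormatEndOnCyl₂` = CYL-SNC ⇒ `IsFormatSncOn` on the cylinder open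
(NOTE G11-22).  The PROOF of T5 (`betaTwo_atomConclusion_of_targets : BetaTwoComposition₂`) is a sibling file (G11-29 (3)(b)), not this one.
No instances, no notation, no facts; review lane (definitions).
-/

noncomputable section

open CategoryTheory CategoryTheory.Limits AlgebraicGeometry TopologicalSpace IsLocalRing
open Literature.AlgebraicGeometry.Resolution Scheme.IdealSheafData
open Literature.AlgebraicGeometry.Hironaka2017.MonomialPart Literature.AlgebraicGeometry.Motives

set_option linter.dupNamespace false

namespace Summit.ResolutionOfSingularities.ResolutionOfSingularities.Theorems

universe u

namespace ChainW52F7Beta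

open DepthMultiHost

/-- [OURS · L1 W5.2] **STEP-STABILITY of a cylinder-state predicate `P`** (RULING G11-24; binder text VERBATIM = res-D-pv-054΄s `hP`
in `MultiHostCJS.transport_of_cjsB`, scratch b2c5637f8a6575fe): `P` survives one lifted cylinder step with all its data and relations.
The POLE-STRUCTURE predicate of T3 (idea-1 P3: the pole-chart atlas off `cyl.V`, incl. the frozen-cylinder regions, NOTE G11-26) is
supplied as such a `P`; the transport calls `hP` only with `ν = 0` and `m` = generic orders. **v5 (NOTE G11-26 (2) / G11-29): RESTRICTED** —
`ν := 0` literally (total-transform bookkeeping) and `m` MAXIMAL (`∀ i, ¬ cyl.tr i ≤ C ^ (m i + 1)`); res-D-pv-054΄s 1″/Loop/Transport adopt this text verbatim. -/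
def StepStable (P : ∀ ⦃X : Scheme.{u}⦄ (S : MultiHostState X), CylState S → Prop) : Prop :=
  ∀ ⦃X X' : Scheme.{u}⦄ [IsLocallyNoetherian X] [IsLocallyNoetherian X'] (S : MultiHostState X)
    (cyl : CylState S) [IsIntegral cyl.Z] [IsNoetherian cyl.Z] (C : cyl.Z.IdealSheafData), C ≠ ⊥ →
    Scheme.IsRegular C.subscheme → C = vanishingIdeal C.support →
    ∀ (𝓑 : List cyl.Z.IdealSheafData), (∀ T ∈ S.𝓔, T ≠ cyl.j.ker → cyl.bd T ∈ 𝓑) → HasSNCWith 𝓑 C →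
    ∀ (τ : X' ⟶ X) (hτ : IsBlowup τ (vanishingIdeal (cyl.centre C))) (η : X), IsGenericPoint η (cyl.centre C : Set X) →
    ∀ (m : Fin S.n → ℕ), (∀ i, cyl.tr i ≤ C ^ m i) → (∀ i, ¬ cyl.tr i ≤ C ^ (m i + 1)) →
    ∀ (hsncX : HasSNCWith S.𝓔 (vanishingIdeal (cyl.centre C)))
      (cyl' : CylState (S.step τ (cyl.centre C) η m 0 hsncX hτ)) (τZ : cyl'.Z ⟶ cyl.Z),
      IsBlowup τZ C → cyl'.j ≫ τ = τZ ≫ cyl.j →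
      cyl'.j.ker = strictTransformIdeal τ (vanishingIdeal (cyl.centre C)) cyl.j.ker →
      (∀ i, cyl'.tr i = controlledTransform τZ C (cyl.tr i) (m i)) →
      (∀ T ∈ S.𝓔, T ≠ cyl.j.ker →
        cyl'.bd (strictTransformIdeal τ (vanishingIdeal (cyl.centre C)) T) = strictTransformIdeal τZ C (cyl.bd T)) →
      cyl'.bd ((vanishingIdeal (cyl.centre C)).comap τ) = C.comap τZ → ((cyl'.V : Set X') ⊆ τ ⁻¹' (cyl.V : Set X)) →
      P S cyl → P (S.step τ (cyl.centre C) η m 0 hsncX hτ) cyl'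

/-- [OURS · L1 W5.2] **T2 `CJSTransport₂`** — the X-side transport of ONE F-32bR run on the carrier of a boundary-free cylinder
state (res-D-pv-054 `MultiHostCJS.transport_of_cjsB`, modulo the lift hypothesis `hlift` = X2a module 2 and the named fact
`CossartJannsenSaito2020EmbeddedSequenceB`). -/
def CJSTransport₂ : Prop :=
  ∀ (P : ∀ ⦃X : Scheme.{u}⦄ (S : MultiHostState X), CylState S → Prop), StepStable P →
  ∀ {X₀ : Scheme.{u}} [IsNoetherian X₀], Scheme.IsRegular X₀ → ∀ (S₀ : MultiHostState X₀) (cyl₀ : CylState S₀)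
    [IsIntegral cyl₀.Z] [IsNoetherian cyl₀.Z], Scheme.IsRegular cyl₀.Z → Scheme.IsExcellent cyl₀.Z →
    topologicalKrullDim cyl₀.Z = 3 → (∀ T ∈ S₀.𝓔, T = cyl₀.j.ker) → P S₀ cyl₀ →
    ∃ (X₁ : Scheme.{u}) (π : X₁ ⟶ X₀) (_ : IsNoetherian X₁) (S₁ : MultiHostState X₁) (cyl₁ : CylState S₁)
      (ρ : cyl₁.Z ⟶ cyl₀.Z) (_ : IsIntegral cyl₁.Z) (_ : IsNoetherian cyl₁.Z) (𝓔 : List cyl₁.Z.IdealSheafData),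
      P S₁ cyl₁ ∧ (∃ Q : X₀.IdealSheafData, IsBlowup π Q ∧ (Q.support : Set X₀) ⊆ Set.range cyl₀.j) ∧
      Scheme.IsRegular X₁ ∧ S₁.K = S₀.K.comap π ∧ S₁.n = S₀.n ∧ cyl₁.j ≫ π = ρ ≫ cyl₀.j ∧
      Scheme.IsRegular cyl₁.Z ∧
      HasSNC 𝓔 ∧ 𝓔.Nodup ∧
      (∀ T ∈ 𝓔, T ≠ ⊤ → ∃ ζ : cyl₁.Z, T = vanishingIdeal ⟨closure {ζ}, isClosed_closure⟩) ∧
      (∀ T ∈ 𝓔, T ≠ ⊤ → IsIrreducible (T.support : Set cyl₁.Z)) ∧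
      (∀ T ∈ S₁.𝓔, T ≠ cyl₁.j.ker → cyl₁.bd T ∈ 𝓔) ∧
      (∀ i, ∃ c : cyl₁.Z.IdealSheafData → ℕ, cyl₁.tr i = monomialIdeal (𝓔.map fun T => (T, c T)))

/-- [OURS · L1 W5.2] **T2c `FormatEndOnCyl₂`** — at CJS end the state is in STRICT FORMAT-SNC END on the cylinder open:
from ONE snc family `𝓔` on the carrier presenting the boundary traces and every host trace as a monomial, the carrier and
the cylinders over `𝓔` form the format family on `cyl.V` (CYL-SNC from `CylState.param`, NOTE G11-22) and every host is the
monomial of the cylinders. Output currency = `MultiHostState.IsFormatSncOn` (p546954). -/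
def FormatEndOnCyl₂ : Prop :=
  ∀ {X : Scheme.{u}} [IsNoetherian X], Scheme.IsRegular X → ∀ (S : MultiHostState X) (cyl : CylState S)
    [IsIntegral cyl.Z] [IsNoetherian cyl.Z], Scheme.IsRegular cyl.Z → ∀ (𝓔 : List cyl.Z.IdealSheafData),
    HasSNC 𝓔 → 𝓔.Nodup →
    (∀ T ∈ 𝓔, T ≠ ⊤ → IsIrreducible (T.support : Set cyl.Z)) →
    (∀ T ∈ S.𝓔, T ≠ cyl.j.ker → cyl.bd T ∈ 𝓔) →
    (∀ i, ∃ c : cyl.Z.IdealSheafData → ℕ, cyl.tr i = monomialIdeal (𝓔.map fun T => (T, c T))) →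
    ∃ (𝓒 : List X.IdealSheafData) (𝓗 : Fin S.n → List (X.IdealSheafData × ℕ)), S.IsFormatSncOn cyl.V 𝓒 𝓗

/-- [OURS · L1 W5.2] **T0 `InitialMultiHost₂`** — the INITIAL CYLINDER STATE of a (β) d = 2 graded member
`I = (P_j(x))_j + (x_k^4)_k` (quadratic forms `P_j` over a coefficient field `κ₀` of the regular local fourfold `S`): on
`X₁ = Bl_𝔪 Spec S` the depth-two invariant holds for a residual ideal `K` which is the ideal of a boundary-free multi-host state
`St` (hosts = cylinders over the quadrics `V₊(P_j) ⊂ E ≅ ℙ³_{κ₀}` plus the pure N-summand `𝓘_E²`) carried by a cylinder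
state `cyl` whose carrier is (the image of) `E` — PACKAGING over `gradedPackagePow_holds` / `DepthOne.exists_retraction` /
`gradedHostPackagePow_single` plus PARAM at every point (spec v4.2 §7 A2/A3; hand res-D-pv-055). v2 (16:58Z): `IsAdicComplete` binder allowed (Q-T0-1) —
the CORE binder supplies it; used only to read `κ₀[x]_{(x)} → S` as a completion map (regular fibres off `E`). v4 (RULING G11-27):
`Z := ℙ³, j := i, V := ⊤, q := ⊤.ι ≫ R₀`; extra conjuncts `Scheme.IsExcellent X` (`isExcellentRing_of_isAdicComplete` +
`Scheme.isExcellent_Spec_of_isExcellentRing` + `IsBlowup.isExcellent`), `St.n ≠ 0` (there is the `⊤` host) and `cyl.V = ⊤` (feeds `AtlasInitial`).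
v5 (Q-T0-3, res-D-pv-055): binder `∀ j, P j ≠ 0` (host traces must be effective Cartier); T5 reduces a general family to its non-zero
sub-family (`gradedMemberIdeal` ignores zero forms; the all-zero member is the pure monomial `(x_k^4)`, support lemma). -/
def InitialMultiHost₂ : Prop :=
  ∀ (S : Type u) [CommRing S] [IsRegularLocalRing S] [IsAdicComplete (IsLocalRing.maximalIdeal S) S],
    ringKrullDim S = (4 : ℕ) →
  ∀ (κ₀ : Type u) [Field κ₀] (σ : κ₀ →+* S), Function.Bijective ⇑((IsLocalRing.residue S).comp σ) →
  ∀ (x : Fin 4 → S), Ideal.span (Set.range x) = IsLocalRing.maximalIdeal S →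
  ∀ (s : ℕ) (P : Fin s → MvPolynomial (Fin 4) κ₀)
    (hP : ∀ j, P j ∈ MvPolynomial.homogeneousSubmodule (Fin 4) κ₀ 2), (∀ j, P j ≠ 0) →
    ∃ (X : Scheme.{u}) (g : X ⟶ Spec (.of S)) (i : ProjSpace.P 3 κ₀ ⟶ X) (K : X.IdealSheafData)
      (_ : IsNoetherian X) (St : MultiHostState X) (cyl : CylState St) (_ : IsIntegral cyl.Z) (_ : IsNoetherian cyl.Z),
      DepthTargets.DepthInvariant 2 S (DepthTargets.gradedMemberIdeal σ x 2 2 P) (ProjSpace.P 3 κ₀) X i g K ∧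
      Scheme.IsExcellent X ∧ St.K = K ∧ St.n ≠ 0 ∧ (∀ T ∈ St.𝓔, T = cyl.j.ker) ∧ Set.range cyl.j.base ⊆ Set.range i.base ∧
      cyl.V = ⊤ ∧ Scheme.IsRegular cyl.Z ∧ Scheme.IsExcellent cyl.Z ∧ topologicalKrullDim cyl.Z = 3

/-- [OURS · L1 W5.2] **Initial validity of a pole-atlas predicate**: `P` holds of every cylinder state whose cylinder region is
ALL of `X` (empty pole complement) — the generation-0 state of T0 (RULING G11-27 (4)). Supplies T5΄s `h₀ : P S₀ cyl₀`. -/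
def AtlasInitial (P : ∀ ⦃X : Scheme.{u}⦄ (S : MultiHostState X), CylState S → Prop) : Prop :=
  ∀ ⦃X : Scheme.{u}⦄ (S : MultiHostState X) (cyl : CylState S), cyl.V = ⊤ → P S cyl

/-- [OURS · L1 W5.2] **T3 `PhaseCTermination₂ P` — PHASE C (X3), ∃-form, RESIDUAL CURRENCY** (RULING G11-25 A8/A9, spec v4.3 §8;
design owner res-L1-w52-idea-1, typer res-L1-w52-lead-1). For the pole-atlas predicate `P` (idea-1 P3; `StepStable P`,
`AtlasInitial P`): a multi-host state `S` on regular excellent Noetherian `X`, FORMAT-SNC on the cylinder region `cyl.V` (T2c) and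
satisfying `P S cyl` off it, admits a finite sequence `s` of blowings up in REGULAR centres over `cosupp S.K` with regular top on
which the transform of `K` FACTORS as `M · K♭` — `M` effective Cartier (the member-wise minimal monomial, pulled back) and `K♭ = S♭.K`
the ideal of a multi-host state with as many hosts, FORMAT-SNC on an open `U′ ⊇ cosupp K♭` (res-L1-repro-3΄s `S′.residual` is the
canonical `S♭`; `…DepthMultiHostResidual`). Phase C PUSHES THE RESIDUAL COSUPPORT INTO A FORMAT-SNC OPEN: (P-reg) poles reach strict END
(Lemma R/E, Φ-descent, S1♯ with TB1/TB2, tail lemma) and are included in `U′` or principalised locally; (P-cone) poles (an axis host)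
never reach END — the residual is emptied there by order arithmetic; frozen-cylinder regions (NOTE G11-26) by cylindrified
principalisation of the pre-step residual shadow. T5 then applies E1 `isEndOn_of_isFormatSncOn` + T4 `IsEndOn.exists_centreSeq` to `S♭`
VERBATIM and multiplies back by `M`. -/
def PhaseCTermination₂ (P : ∀ ⦃X : Scheme.{u}⦄ (S : MultiHostState X), CylState S → Prop) : Prop :=
  ∀ {X : Scheme.{u}} [IsNoetherian X], Scheme.IsRegular X → Scheme.IsExcellent X →
  ∀ (S : MultiHostState X) (cyl : CylState S) [IsIntegral cyl.Z] [IsNoetherian cyl.Z],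
    Scheme.IsRegular cyl.Z → S.n ≠ 0 →
  ∀ (𝓒 : List X.IdealSheafData) (𝓗 : Fin S.n → List (X.IdealSheafData × ℕ)),
    S.IsFormatSncOn cyl.V 𝓒 𝓗 → P S cyl →
    ∃ (s : CentreSeq X), s.AllRegular ∧ s.CentresOver (S.K.support : Set X) ∧ Scheme.IsRegular s.top ∧
      ∃ (_ : IsNoetherian s.top) (M : s.top.IdealSheafData) (Sf : MultiHostState s.top),
        S.K.comap s.comp = M * Sf.K ∧ IsEffectiveCartier M ∧ Sf.n ≠ 0 ∧
        ∃ (U' : s.top.Opens) (𝓒' : List s.top.IdealSheafData) (𝓗' : Fin Sf.n → List (s.top.IdealSheafData × ℕ)),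
          Sf.IsFormatSncOn U' 𝓒' 𝓗' ∧ (Sf.K.support : Set s.top) ⊆ (U' : Set s.top)

/-- [OURS · L1 W5.2] **T5΄s conclusion — the CORE atom conclusion for (β) d = 2 graded members over a COMPLETE regular local fourfold
with a coefficient field**: `I = (P_j(x))_j + (x_k^4)_k ≠ 0`, `P_j` quadratic forms; every `T = Bl_I Spec S` has ONE further blowing up
along a non-zero ideal cosupported over the closed point with regular source (shape of `DepthTargets.gradedMember_atomConclusion`,
m = 3, d = ℓ = 2). -/
def BetaTwoAtomConclusion₂ : Prop :=
  ∀ (S : Type u) [CommRing S] [IsRegularLocalRing S] [IsAdicComplete (IsLocalRing.maximalIdeal S) S],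
    ringKrullDim S = (4 : ℕ) →
  ∀ (κ₀ : Type u) [Field κ₀] (σ : κ₀ →+* S), Function.Bijective ⇑((IsLocalRing.residue S).comp σ) →
  ∀ (x : Fin 4 → S), Ideal.span (Set.range x) = IsLocalRing.maximalIdeal S →
  ∀ (s : ℕ) (P : Fin s → MvPolynomial (Fin 4) κ₀)
    (_ : ∀ j, P j ∈ MvPolynomial.homogeneousSubmodule (Fin 4) κ₀ 2),
    DepthTargets.gradedMemberIdeal σ x 2 2 P ≠ ⊥ →
  ∀ (T : Scheme.{u}) (f : T ⟶ Spec (.of S)),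
    IsBlowup f (affineBlowup.idealSheaf (DepthTargets.gradedMemberIdeal σ x 2 2 P)) →
    ∃ (J : T.IdealSheafData) (T' : Scheme.{u}) (π : T' ⟶ T), J ≠ ⊥ ∧
      (∀ t : T, t ∈ J.support → f.base t = IsLocalRing.closedPoint S) ∧
      IsBlowup π J ∧ Scheme.IsRegular T'

/-- [OURS · L1 W5.2] **T5 `betaTwo_atomConclusion_of_targets` — the COMPOSITION STATEMENT** (to be PROVED in `ChainW52TargetsF7Beta.lean`
or a sibling by the T5 typer; pattern `atomConclusion_of_tower`, `…TowerContraction` l.114): T0, T2, T2c and ONE pole atlas `P` with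
`StepStable P`, `AtlasInitial P`, `PhaseCTermination₂ P` give the (β) d = 2 atom conclusion. The final closer reads
`… (hCJS : CossartJannsenSaito2020EmbeddedSequenceB) := betaTwo_atomConclusion_of_targets T0_holds (cjsTransport₂_of_cjsB hlift hCJS) T2c_holds ⟨P, hP, hP₀, hC⟩`. -/
def BetaTwoComposition₂ : Prop :=
  InitialMultiHost₂.{u} → CJSTransport₂.{u} → FormatEndOnCyl₂.{u} →
    (∃ P : ∀ ⦃X : Scheme.{u}⦄ (S : MultiHostState X), CylState S → Prop,
      StepStable P ∧ AtlasInitial P ∧ PhaseCTermination₂ P) →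
    BetaTwoAtomConclusion₂.{u}

/-!
## Pending (not typed here)
* (TYPED above in v4 — kept for the record) **T3 `PhaseCTermination₂`** (X3, ∃-form; RULING G11-25 A8/A9 RESIDUAL CURRENCY; the atlas `P` itself = idea-1 g12 P3):
  input = a state `S` on regular Noetherian excellent `X` with `S.IsFormatSncOn V 𝓒 𝓗` on the cylinder open `V` (T2c) and
  `P S cyl` for the POLE-CHART ATLAS predicate `P` (step-stable, `StepStable P`; it describes `X ∖ V`: pole sections σ_k(C_k) on the
  k-th exceptional member AND the frozen-cylinder regions `Cyl(C_k)˜ ∩ (older members)` — NOTE G11-26); output =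
  `∃ s : CentreSeq X` (AllRegular, every centre inside the exceptional members, i.e. over `cosupp S.K`) and a state `S′` on `s.top`
  with `S′.K = S.K.comap s.comp`, `S′.n = S.n`, and `∃ U′ 𝓒′ 𝓗′, S′.IsFormatSncOn U′ 𝓒′ 𝓗′ ∧ cosupp S′.residual.K ⊆ U′`
  (`MultiHostState.residual`, res-L1-repro-3 `…DepthMultiHostResidual.lean`: `S.K = M * S.residual.K`, M the member-wise minimal
  monomial). Phase C PUSHES THE RESIDUAL COSUPPORT INTO A FORMAT-SNC OPEN; at poles through a cone axis the residual is emptied by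
  order arithmetic (END is unreachable there, A9); E1 `isEndOn_of_isFormatSncOn` and T4 `IsEndOn.exists_centreSeq` are then applied
  VERBATIM to `S′.residual` (`isFormatSncOn_residual_iff`).
* **T5** `betaTwoMember_atomConclusion_of_targets : InitialMultiHost₂ → CJSTransport₂ → FormatEndOnCyl₂ → PhaseCTermination₂ →
  ∀ (β) d = 2 member, CORE binder` (pattern `atomConclusion_of_tower`, `…TowerContraction` l.114): concatenate the blow-ups of T2
  (`∃ Q, IsBlowup π Q ∧ supp Q ⊆ range cyl₀.j ⊆ range i = g⁻¹(closed point)`), T3 and T4 (centres over cosupp K ⊆ E-images ⊆ over the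
  closed point; tree `IsBlowup.exists_isBlowup_comp_supported`), read `I𝒪_top = M · K_top` from `DepthInvariant.exists_format` transported
  along the tower and `K_top = M′ · K♭_top` (A8); M, M′ pull back to locally principal ideals, K♭_top is principalised by E1+T4 on the
  residual state ⇒ `IsLocallyPrincipal`, top regular ⇒ CORE via `atomConclusion_of_tower`. `CJSTransport₂` is supplied as `transport_of_cjsB hlift hCJS` (pv-054) with `hlift` discharged by module 2
  (G11-21) and `hCJS : CossartJannsenSaito2020EmbeddedSequenceB` the ONLY named-fact binder of the composition.
-/

end ChainW52F7Beta

end Summit.ResolutionOfSingularities.ResolutionOfSingularities.Theorems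

end
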